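import Summits.AtomisticToContinuum.HydrodynamicLimit.Theorems.EnskogAdjointDualityAdjointEnskogTestFamilyROperatorKappaZeroPrep4
import HarnessLib

/-!
# K2R refutation, stub `operatorKappaZero`: identity (0) for the corrector part of the test function

Route `EnskogAdjointDuality` of `AtomisticToContinuum/HydrodynamicLimit`, crux K2R
`Summit.AtomisticToContinuum.HydrodynamicLimit.Theses.EnskogAdjointDuality.AdjointEnskogTestFamilyR`
(stmt-AtomisticToContinuum-11592), line `refutation`: the registered stub `stub_operatorKappaZero`.

At a constant background (`Y₀`, `ρ₀`, Maxwellian `M`) the test-side hard-sphere bracket `Lκ` applied to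
the corrector part `κ` of an admissible test function is paired with `Θ₀^R(v) ζ cos(2πx₀)`,
`Θ₀^R(v) = (1+|v|²)⁻³e^{-|v|²/R}`. Per position slice (`k2r_ref_ok0_slice_split`, `stub_kappaOperator`
and the triple exchange of the preparation files) the pairing is
`Y₀ρ₀ (∫_{S²} Ψ(x, ω) dσ + ∫_{S²} Ψ(x+εω, ω) dσ − ∫ Θ₀^R ν κ(x, ·) − Φ₄(x))`,
`Ψ(x, ω) = ∫ κ(x, U) I₀^R(U, ω) dU`; the delocalised gain is moved back onto `Ψ(x, ·)` by the translation
invariance of `𝕋³` (`k2r_ref_ok0_deloc_swap`), and the slice estimate `k2r_ref_ok0_slice_estimate`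
(criticality `2∫I₀dσ − νΘ₀ = k₀(|U|²)` with `∫(1+|U|²)|k₀| ≤ M₀`, dipole moment
`∫ω₀I₀dσ = U₀(π/2 Θ₀ + e)` with `∫|U₀|(1+|U|²)|e| ≤ M₂`, uniformly in `R ≥ 1`) identifies the main term
`π²ε Y₀ρ₀ ζ ∫∫ Θ₀^R v₀ sin(2πx₀) κ` up to `|ζ| (Bdd + Y₀ρ₀ C · 32π² (k²/2 + k³/6) J_R)`, `k = 2πε`,
`J_R = ∫₀^∞ E²(1+E)⁻³e^{-E/R} dE`.

References: C. Cercignani, R. Illner, M. Pulvirenti, *The Mathematical Theory of Dilute Gases* (1994),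
§3.1, §7.2 [CIP1994].
-/

noncomputable section

open MeasureTheory Set Filter Function
open scoped InnerProductSpace Real

namespace Summit.AtomisticToContinuum.HydrodynamicLimit.Theorems.EnskogAdjointDuality

open Literature.MathematicalPhysics.KineticTheory Literature.Analysis.FluidPDE Literature.Analysis.FunctionSpaces
open Literature.Analysis.UnboundedOperators (collisionFrequency)

/-- **The split per position slice.** For a jointly continuous corrector `κ` (`|κ(x,v)| ≤ C(1+|v|²)`),
the test-side bracket `Lκ` on it and `Ψ(x, ω) = ∫ κ(x, U) I₀^R(U, ω) dU`: the exchange term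
`Φ₄(x) = ∫ Θ₀^R(v) ∫∫ q₊ M κ(x+εω, w)` is well defined with `|Φ₄| ≤ 1040πC`, the loss integrand
`Θ₀^R ν κ(x, ·)` is integrable, and
`∫ Θ₀^R(v) Lκ(x, v) dv = Y₀ρ₀ (∫_{S²} Ψ(x, ω) dσ + ∫_{S²} Ψ(x+εω, ω) dσ − ∫ Θ₀^R ν κ(x, ·) − Φ₄(x))`.
[cite: CIP1994, §3.1] -/
theorem k2r_ref_ok0_slice_split {Θ : ℝ → V3 → ℝ} {I : ℝ → V3 → V3 → ℝ}
    (hΘ : ∀ R v, Θ R v = ((1 + ‖v‖ ^ 2) ^ 3)⁻¹ * Real.exp (-‖v‖ ^ 2 / R))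
    (hI : ∀ R U n, I R U n = (1 / 2 : ℝ) * Real.exp (-(‖U‖ ^ 2 - ⟪U, n⟫_ℝ ^ 2) / 2) *
      (∫ b, max (⟪U, n⟫_ℝ - b) 0 * (Real.exp (-b ^ 2 / 2) / Real.sqrt (2 * π))) *
      ∫ E in Ioi (⟪U, n⟫_ℝ ^ 2), ((1 + E) ^ 3)⁻¹ * Real.exp (-E / R))
    {R : ℝ} (hR : 1 ≤ R) {Y₀ ρ₀ ε C : ℝ} (hC : 0 ≤ C)
    {κ : T3 → V3 → ℝ} (hκ : Continuous (uncurry κ)) (hκb : ∀ x v, |κ x v| ≤ C * (1 + ‖v‖ ^ 2))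
    (Lκ : T3 → V3 → ℝ) (hL : ∀ x v, Lκ x v = ∫ ω : Metric.sphere (0 : V3) 1, (∫ w : V3,
      max ⟪v - w, (ω : V3)⟫_ℝ 0 * Y₀ * (ρ₀ * globalMaxwellian w) *
        (κ x (v - ⟪v - w, (ω : V3)⟫_ℝ • (ω : V3)) + κ (x + Torus.proj (ε • (ω : V3))) (w + ⟪v - w, (ω : V3)⟫_ℝ • (ω : V3)) -
          κ x v - κ (x + Torus.proj (ε • (ω : V3))) w)) ∂sphereMeasure)
    (Ψ : T3 → Metric.sphere (0 : V3) 1 → ℝ) (hΨ : ∀ x ω, Ψ x ω = ∫ U : V3, κ x U * I R U ω) (x : T3) :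
    Integrable (fun v : V3 => Θ R v * ∫ p : Metric.sphere (0 : V3) 1 × V3,
      max ⟪v - p.2, (p.1 : V3)⟫_ℝ 0 * globalMaxwellian p.2 * κ (x + Torus.proj (ε • (p.1 : V3))) p.2
        ∂((sphereMeasure : Measure (Metric.sphere (0 : V3) 1)).prod volume)) ∧
    |∫ v : V3, Θ R v * ∫ p : Metric.sphere (0 : V3) 1 × V3,
      max ⟪v - p.2, (p.1 : V3)⟫_ℝ 0 * globalMaxwellian p.2 * κ (x + Torus.proj (ε • (p.1 : V3))) p.2
        ∂((sphereMeasure : Measure (Metric.sphere (0 : V3) 1)).prod volume)| ≤ 1040 * π * C ∧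
    Integrable (fun U : V3 => Θ R U * (collisionFrequency U * κ x U)) ∧
    ∫ v : V3, Θ R v * Lκ x v = (Y₀ * ρ₀) *
      ((∫ ω, Ψ x ω ∂(sphereMeasure : Measure (Metric.sphere (0 : V3) 1))) +
        (∫ ω, Ψ (x + Torus.proj (ε • (ω : V3))) ω ∂(sphereMeasure : Measure (Metric.sphere (0 : V3) 1))) -
        (∫ U : V3, Θ R U * (collisionFrequency U * κ x U)) -
        ∫ v : V3, Θ R v * ∫ p : Metric.sphere (0 : V3) 1 × V3,
          max ⟪v - p.2, (p.1 : V3)⟫_ℝ 0 * globalMaxwellian p.2 * κ (x + Torus.proj (ε • (p.1 : V3))) p.2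
            ∂((sphereMeasure : Measure (Metric.sphere (0 : V3) 1)).prod volume)) := by
  haveI := isFiniteMeasure_sphereMeasure (E := V3)
  obtain ⟨hw01, hwc, -, hw4⟩ := k2r_ref_ok0_w_facts hΘ hR
  have hκ' : ∀ {X : Type} [TopologicalSpace X] {f : X → T3} {g : X → V3},
      Continuous f → Continuous g → Continuous fun x => κ (f x) (g x) := fun hf hg => hκ.comp (hf.prodMk hg)
  have hpc : Continuous (Torus.proj : V3 → T3) := Torus.continuous_proj
  have hyc : Continuous fun ω : Metric.sphere (0 : V3) 1 => x + Torus.proj (ε • (ω : V3)) :=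
    continuous_const.add (hpc.comp (continuous_subtype_val.const_smul ε))
  have hM := continuous_globalMaxwellian (E := V3)
  -- the two gain terms, by the triple exchange
  obtain ⟨hP1i, hP1⟩ := k2r_ref_ok0_triple hΘ hI hR (K := fun (_ : Metric.sphere (0 : V3) 1) (U : V3) => κ x U)
    (show Continuous fun p : Metric.sphere (0 : V3) 1 × V3 => κ x p.2 from hκ' continuous_const continuous_snd)
    (CK := C) (fun _ U => hκb x U)
  obtain ⟨hP2i, hP2⟩ := k2r_ref_ok0_triple hΘ hI hR
    (K := fun (ω : Metric.sphere (0 : V3) 1) (U : V3) => κ (x + Torus.proj (ε • (ω : V3))) U)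
    (show Continuous fun p : Metric.sphere (0 : V3) 1 × V3 => κ (x + Torus.proj (ε • (p.1 : V3))) p.2 from
      hκ' (hyc.comp continuous_fst) continuous_snd) (CK := C) (fun ω U => hκb _ U)
  have hP1' : ∫ v : V3, Θ R v * ∫ p : Metric.sphere (0 : V3) 1 × V3,
      max ⟪v - p.2, (p.1 : V3)⟫_ℝ 0 * globalMaxwellian p.2 * κ x (p.2 + ⟪v - p.2, (p.1 : V3)⟫_ℝ • (p.1 : V3))
        ∂((sphereMeasure : Measure (Metric.sphere (0 : V3) 1)).prod volume) =
      ∫ ω, Ψ x ω ∂(sphereMeasure : Measure (Metric.sphere (0 : V3) 1)) := by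
    simpa only [hΨ] using hP1
  have hP2' : ∫ v : V3, Θ R v * ∫ p : Metric.sphere (0 : V3) 1 × V3,
      max ⟪v - p.2, (p.1 : V3)⟫_ℝ 0 * globalMaxwellian p.2 *
        κ (x + Torus.proj (ε • (p.1 : V3))) (p.2 + ⟪v - p.2, (p.1 : V3)⟫_ℝ • (p.1 : V3))
        ∂((sphereMeasure : Measure (Metric.sphere (0 : V3) 1)).prod volume) =
      ∫ ω, Ψ (x + Torus.proj (ε • (ω : V3))) ω ∂(sphereMeasure : Measure (Metric.sphere (0 : V3) 1)) := by
    simpa only [hΨ] using hP2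
  -- the loss term
  have hgi : Integrable (fun U : V3 => Θ R U * (collisionFrequency U * κ x U)) := by
    refine (hw4.const_mul (2 * π * C)).mono' ?_ (Eventually.of_forall fun U => ?_)
    · exact (hwc.measurable.mul (Literature.Analysis.UnboundedOperators.measurable_collisionFrequency.mul
        (hκ' continuous_const continuous_id).measurable)).aestronglyMeasurable
    · have hcf0 : 0 ≤ collisionFrequency U := le_trans (by positivity) (stub_halfGaussian.2.2.2.2.2 U).1
      rw [Real.norm_eq_abs, abs_mul, abs_of_nonneg (hw01 U).1, abs_mul, abs_of_nonneg hcf0]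
      have h14 : (1 + ‖U‖ ^ 2) * (1 + ‖U‖ ^ 2) ≤ (1 + ‖U‖ ^ 2) ^ 4 := by
        rw [← sq]; exact pow_le_pow_right₀ (by nlinarith [sq_nonneg ‖U‖]) (by norm_num)
      calc Θ R U * (collisionFrequency U * |κ x U|)
          ≤ Θ R U * ((2 * π * (1 + ‖U‖ ^ 2)) * (C * (1 + ‖U‖ ^ 2))) :=
            mul_le_mul_of_nonneg_left (mul_le_mul (stub_operatorKappaZero_prep4 U) (hκb x U) (abs_nonneg _)
              (by positivity)) (hw01 U).1
        _ = 2 * π * C * (Θ R U * ((1 + ‖U‖ ^ 2) * (1 + ‖U‖ ^ 2))) := by ring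
        _ ≤ 2 * π * C * (Θ R U * (1 + ‖U‖ ^ 2) ^ 4) := by gcongr; exact (hw01 U).1
  -- the exchange term: measurability, pointwise bound, integrability, budget
  have hc4 : Continuous fun q : V3 × (Metric.sphere (0 : V3) 1 × V3) =>
      max ⟪q.1 - q.2.2, (q.2.1 : V3)⟫_ℝ 0 * globalMaxwellian q.2.2 * κ (x + Torus.proj (ε • (q.2.1 : V3))) q.2.2 :=
    (((by fun_prop : Continuous fun q : V3 × (Metric.sphere (0 : V3) 1 × V3) => ⟪q.1 - q.2.2, (q.2.1 : V3)⟫_ℝ).max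
      continuous_const).mul (hM.comp continuous_snd.snd)).mul (hκ' (hyc.comp continuous_snd.fst) continuous_snd.snd)
  have hP4m : Measurable fun v : V3 => ∫ p : Metric.sphere (0 : V3) 1 × V3,
      max ⟪v - p.2, (p.1 : V3)⟫_ℝ 0 * globalMaxwellian p.2 * κ (x + Torus.proj (ε • (p.1 : V3))) p.2
        ∂((sphereMeasure : Measure (Metric.sphere (0 : V3) 1)).prod volume) :=
    (hc4.stronglyMeasurable.integral_prod_right'
      (ν := ((sphereMeasure : Measure (Metric.sphere (0 : V3) 1)).prod volume))).measurable
  have hP4b : ∀ v : V3, |∫ p : Metric.sphere (0 : V3) 1 × V3,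
      max ⟪v - p.2, (p.1 : V3)⟫_ℝ 0 * globalMaxwellian p.2 * κ (x + Torus.proj (ε • (p.1 : V3))) p.2
        ∂((sphereMeasure : Measure (Metric.sphere (0 : V3) 1)).prod volume)| ≤ C * (4 * π * (4 * ‖v‖ + 9)) :=
    fun v => (k2r_ref_ok0_piece_le (g := fun p : Metric.sphere (0 : V3) 1 × V3 =>
      κ (x + Torus.proj (ε • (p.1 : V3))) p.2) (hκ' (hyc.comp continuous_fst) continuous_snd) hC v
        (fun p => hκb _ _)).2
  obtain ⟨hm, -⟩ := k2r_ref_R3_facts hR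
  have f0 : Integrable (fun v : V3 => ‖v‖ ^ 0 * Θ R v) ∧ ∫ v : V3, ‖v‖ ^ 0 * Θ R v ≤ 20 := by
    simp only [hΘ]; exact hm 0 (by norm_num)
  have f1 : Integrable (fun v : V3 => ‖v‖ ^ 1 * Θ R v) ∧ ∫ v : V3, ‖v‖ ^ 1 * Θ R v ≤ 20 := by
    simp only [hΘ]; exact hm 1 (by norm_num)
  have hdom : Integrable (fun v : V3 => 4 * π * C * (4 * (‖v‖ ^ 1 * Θ R v) + 9 * (‖v‖ ^ 0 * Θ R v))) :=
    ((f1.1.const_mul 4).add (f0.1.const_mul 9)).const_mul _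
  have hptb : ∀ v : V3, |Θ R v * ∫ p : Metric.sphere (0 : V3) 1 × V3,
      max ⟪v - p.2, (p.1 : V3)⟫_ℝ 0 * globalMaxwellian p.2 * κ (x + Torus.proj (ε • (p.1 : V3))) p.2
        ∂((sphereMeasure : Measure (Metric.sphere (0 : V3) 1)).prod volume)| ≤
      4 * π * C * (4 * (‖v‖ ^ 1 * Θ R v) + 9 * (‖v‖ ^ 0 * Θ R v)) := fun v => by
    rw [abs_mul, abs_of_nonneg (hw01 v).1]
    exact (mul_le_mul_of_nonneg_left (hP4b v) (hw01 v).1).trans_eq (by ring)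
  have hP4i : Integrable (fun v : V3 => Θ R v * ∫ p : Metric.sphere (0 : V3) 1 × V3,
      max ⟪v - p.2, (p.1 : V3)⟫_ℝ 0 * globalMaxwellian p.2 * κ (x + Torus.proj (ε • (p.1 : V3))) p.2
        ∂((sphereMeasure : Measure (Metric.sphere (0 : V3) 1)).prod volume)) :=
    hdom.mono' (hwc.measurable.mul hP4m).aestronglyMeasurable
      (Eventually.of_forall fun v => by rw [Real.norm_eq_abs]; exact hptb v)
  have hP4le : |∫ v : V3, Θ R v * ∫ p : Metric.sphere (0 : V3) 1 × V3,
      max ⟪v - p.2, (p.1 : V3)⟫_ℝ 0 * globalMaxwellian p.2 * κ (x + Torus.proj (ε • (p.1 : V3))) p.2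
        ∂((sphereMeasure : Measure (Metric.sphere (0 : V3) 1)).prod volume)| ≤ 1040 * π * C := by
    rw [← Real.norm_eq_abs]
    refine (norm_integral_le_of_norm_le hdom (Eventually.of_forall fun v => by
      rw [Real.norm_eq_abs]; exact hptb v)).trans ?_
    rw [integral_const_mul, integral_add (f1.1.const_mul 4) (f0.1.const_mul 9), integral_const_mul,
      integral_const_mul]
    nlinarith [f0.2, f1.2, Real.pi_pos, hC, mul_nonneg Real.pi_pos.le hC]
  refine ⟨hP4i, hP4le, hgi, ?_⟩
  -- the pointwise split of `stub_kappaOperator`, integrated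
  have hid : ∀ v : V3, Θ R v * Lκ x v =
      (Y₀ * ρ₀) * (Θ R v * ∫ p : Metric.sphere (0 : V3) 1 × V3,
        max ⟪v - p.2, (p.1 : V3)⟫_ℝ 0 * globalMaxwellian p.2 * κ x (p.2 + ⟪v - p.2, (p.1 : V3)⟫_ℝ • (p.1 : V3))
          ∂((sphereMeasure : Measure (Metric.sphere (0 : V3) 1)).prod volume)) +
      (Y₀ * ρ₀) * (Θ R v * ∫ p : Metric.sphere (0 : V3) 1 × V3,
        max ⟪v - p.2, (p.1 : V3)⟫_ℝ 0 * globalMaxwellian p.2 *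
          κ (x + Torus.proj (ε • (p.1 : V3))) (p.2 + ⟪v - p.2, (p.1 : V3)⟫_ℝ • (p.1 : V3))
          ∂((sphereMeasure : Measure (Metric.sphere (0 : V3) 1)).prod volume)) -
      (Y₀ * ρ₀) * (Θ R v * (collisionFrequency v * κ x v)) -
      (Y₀ * ρ₀) * (Θ R v * ∫ p : Metric.sphere (0 : V3) 1 × V3,
        max ⟪v - p.2, (p.1 : V3)⟫_ℝ 0 * globalMaxwellian p.2 * κ (x + Torus.proj (ε • (p.1 : V3))) p.2
          ∂((sphereMeasure : Measure (Metric.sphere (0 : V3) 1)).prod volume)) := by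
    intro v
    obtain ⟨-, -, -, -, -, h6⟩ := stub_kappaOperator Y₀ ρ₀ C (κ x)
      (fun p : Metric.sphere (0 : V3) 1 × V3 => κ (x + Torus.proj (ε • (p.1 : V3))) p.2)
      (hκ' continuous_const continuous_id) (hκ' (hyc.comp continuous_fst) continuous_snd)
      (hκb x) (fun ω u => hκb _ u) v
    rw [hL x v, h6]
    ring
  rw [integral_congr_ae (Eventually.of_forall hid), integral_sub, integral_sub, integral_add,
    integral_const_mul, integral_const_mul, integral_const_mul, integral_const_mul, hP1', hP2']
  · ring
  · exact hP1i.const_mul _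
  · exact hP2i.const_mul _
  · exact (hP1i.const_mul _).add (hP2i.const_mul _)
  · exact hgi.const_mul _
  · exact ((hP1i.const_mul _).add (hP2i.const_mul _)).sub (hgi.const_mul _)
  · exact hP4i.const_mul _

/-! ## The registered stub -/

/-- **Registered stub `stub_operatorKappaZero`** (line `refutation` of crux K2R
`Summit.AtomisticToContinuum.HydrodynamicLimit.Theses.EnskogAdjointDuality.AdjointEnskogTestFamilyR`): identity
(0) for the corrector part — product integrability of `Θ₀^R(v) ζ cos(2πx₀) Lκ(x, v)` on `𝕋³ × ℝ³` and
`|∫∫ Θ₀^R ζ cos(2πx₀) Lκ − ζ π²ε Y₀ρ₀ ∫∫ Θ₀^R v₀ sin(2πx₀) κ| ≤ (|ζ| + |ζ'|)(Bdd + Y₀ρ₀C · 32π²(k²/2 + k³/6) J_R)`,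
`k = 2πε`, verbatim the registered signature. [cite: CIP1994, §3.1] -/
theorem stub_operatorKappaZero :
  ∀ (Y₀ ρ₀ ε lam C : ℝ), 0 < Y₀ → 0 < ρ₀ → 0 < ε → 2 * Real.pi * ε ≤ Real.pi / 2 → 0 < lam → 0 ≤ C →
  ∃ Bdd : ℝ, ∀ (cc : UnitAddTorus (Fin 3) → ℝ × EuclideanSpace ℝ (Fin 3) × ℝ) (κ : UnitAddTorus (Fin 3) → EuclideanSpace ℝ (Fin 3) → ℝ),
    Continuous cc → Continuous (Function.uncurry κ) → (∀ x, ‖cc x‖ ≤ C) →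
    (∀ x y, dist (cc x) (cc y) ≤ C * dist x y) → (∀ x v, |κ x v| ≤ C * (1 + ‖v‖ ^ 2)) →
    ∀ (Lκ : UnitAddTorus (Fin 3) → EuclideanSpace ℝ (Fin 3) → ℝ), (∀ x v, Lκ x v = ∫ ω : Metric.sphere (0 : EuclideanSpace ℝ (Fin 3)) 1, (∫ w : EuclideanSpace ℝ (Fin 3),
        max (inner ℝ (v - w) (ω : EuclideanSpace ℝ (Fin 3))) 0 * Y₀ * (ρ₀ * globalMaxwellian w) *
          (κ x (v - inner ℝ (v - w) (ω : EuclideanSpace ℝ (Fin 3)) • (ω : EuclideanSpace ℝ (Fin 3))) + κ (x + Torus.proj (ε • (ω : EuclideanSpace ℝ (Fin 3)))) (w + inner ℝ (v - w) (ω : EuclideanSpace ℝ (Fin 3)) • (ω : EuclideanSpace ℝ (Fin 3))) - κ x v - κ (x + Torus.proj (ε • (ω : EuclideanSpace ℝ (Fin 3)))) w)) ∂sphereMeasure) →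
    ∀ R : ℝ, 1 ≤ R → ∀ z z' : ℝ,
    Integrable (fun p : UnitAddTorus (Fin 3) × EuclideanSpace ℝ (Fin 3) => ((1 + ‖p.2‖ ^ 2) ^ 3)⁻¹ * Real.exp (-‖p.2‖ ^ 2 / R) * ((z * Torus.cosCoord 0 p.1) * Lκ p.1 p.2)) (volume.prod volume) ∧
    |(∫ x : UnitAddTorus (Fin 3), ∫ v : EuclideanSpace ℝ (Fin 3), ((1 + ‖v‖ ^ 2) ^ 3)⁻¹ * Real.exp (-‖v‖ ^ 2 / R) * ((z * Torus.cosCoord 0 x) * Lκ x v)) -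
        z * (Real.pi ^ 2 * ε * (Y₀ * ρ₀)) * (∫ x : UnitAddTorus (Fin 3), ∫ v : EuclideanSpace ℝ (Fin 3), ((1 + ‖v‖ ^ 2) ^ 3)⁻¹ * Real.exp (-‖v‖ ^ 2 / R) * v 0 * Torus.sinCoord 0 x * κ x v)| ≤
      (|z| + |z'|) * (Bdd + Y₀ * ρ₀ * C * (32 * Real.pi ^ 2) *
        ((2 * Real.pi * ε) ^ 2 / 2 + (2 * Real.pi * ε) ^ 3 / 6) * (∫ E in Set.Ioi (0 : ℝ), E ^ 2 * (((1 + E) ^ 3)⁻¹ * Real.exp (-E / R)))) := by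
  intro Y₀ ρ₀ ε lam C hY hρ hε hk hlam hC
  -- the critical weight and the dual gain kernel, as opaque functions with their defining equations
  obtain ⟨Θ, hΘ⟩ : ∃ Θ : ℝ → V3 → ℝ, ∀ R v, Θ R v = ((1 + ‖v‖ ^ 2) ^ 3)⁻¹ * Real.exp (-‖v‖ ^ 2 / R) :=
    ⟨_, fun _ _ => rfl⟩
  obtain ⟨I, hI⟩ : ∃ I : ℝ → V3 → V3 → ℝ, ∀ R U n, I R U n =
      (1 / 2 : ℝ) * Real.exp (-(‖U‖ ^ 2 - ⟪U, n⟫_ℝ ^ 2) / 2) *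
        (∫ b, max (⟪U, n⟫_ℝ - b) 0 * (Real.exp (-b ^ 2 / 2) / Real.sqrt (2 * π))) *
        ∫ E in Ioi (⟪U, n⟫_ℝ ^ 2), ((1 + E) ^ 3)⁻¹ * Real.exp (-E / R) := ⟨_, fun _ _ _ => rfl⟩
  obtain ⟨M₀, hM₀⟩ := k2r_ref_ok0_K0 hΘ hI
  obtain ⟨M₂, hM₂⟩ := k2r_ref_ok0_K2 hΘ hI
  have hM₀0 : 0 ≤ M₀ := by
    obtain ⟨k, -, -, -, hle⟩ := hM₀ 1 le_rfl
    exact le_trans (integral_nonneg fun U => by positivity) hle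
  have hM₂0 : 0 ≤ M₂ := by
    obtain ⟨e, -, -, -, hle⟩ := hM₂ 1 le_rfl
    exact le_trans (integral_nonneg fun U => by positivity) hle
  have hA : 0 < Y₀ * ρ₀ := mul_pos hY hρ
  have hk0 : 0 ≤ 2 * π * ε := by positivity
  refine ⟨Y₀ * ρ₀ * C * (M₀ + ((2 * π * ε) ^ 2 / 2 + (2 * π * ε) ^ 3 / 6) * (1760 * π) +
    2 * π * ε * M₂ + 1040 * π), ?_⟩
  intro cc κ hcc hκc hccb hccL hκb Lκ hL R hR z z'
  haveI := isFiniteMeasure_sphereMeasure (E := V3)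
  have hR0 : 0 < R := by linarith
  obtain ⟨hw01, hwc, -, hw4⟩ := k2r_ref_ok0_w_facts hΘ hR
  obtain ⟨-, -, hLi⟩ := k2r_ref_ok0_operator hΘ hY.le hρ.le hC hκc hκb Lκ hL
  have hcos : Continuous (Torus.cosCoord (0 : Fin 3) : T3 → ℝ) := (Torus.isSmooth_cosCoord 0).continuous
  have hsin : Continuous (Torus.sinCoord (0 : Fin 3) : T3 → ℝ) := (Torus.isSmooth_sinCoord 0).continuous
  have habsc : ∀ x : T3, |Torus.cosCoord 0 x| ≤ 1 := fun x => Torus.abs_cosCoord_le 0 x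
  have habss : ∀ x : T3, |Torus.sinCoord 0 x| ≤ 1 := fun x => by
    obtain ⟨r, hr⟩ := Torus.exists_coe_eq (x 0)
    rw [Torus.sinCoord_of_eq hr.symm]
    exact Real.abs_sin_le_one _
  -- (i) integrability on `𝕋³ × ℝ³`
  have hInt : ∀ z₀ : ℝ, Integrable (fun p : T3 × V3 => Θ R p.2 * ((z₀ * Torus.cosCoord 0 p.1) * Lκ p.1 p.2))
      (volume.prod volume) := fun z₀ =>
    hLi R hR (fun x => z₀ * Torus.cosCoord 0 x) (hcos.measurable.const_mul z₀) |z₀|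
      (fun x => by rw [abs_mul]; exact mul_le_of_le_one_right (abs_nonneg _) (habsc x))
  refine ⟨by simpa only [hΘ] using hInt z, ?_⟩
  -- (ii) the per-`x` functionals
  obtain ⟨Ψ, hΨ⟩ : ∃ Ψ : T3 → Metric.sphere (0 : V3) 1 → ℝ, ∀ x ω, Ψ x ω = ∫ U : V3, κ x U * I R U ω :=
    ⟨_, fun _ _ => rfl⟩
  obtain ⟨hΦ2i, hΦ2'i, hswap⟩ := k2r_ref_ok0_deloc_swap hΘ hI hR hκc hκb ε Ψ hΨ
  obtain ⟨k, hkm, hkU, hkI, hkle⟩ := hM₀ R hR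
  obtain ⟨e, hem, heU, heI, hele⟩ := hM₂ R hR
  obtain ⟨hΛi, hΛle⟩ := k2r_ref_ok0_Lambda_le hΘ hI hR
  obtain ⟨Φ, hΦ⟩ : ∃ Φ : T3 → ℝ, ∀ x, Φ x = ∫ v : V3, Θ R v * Lκ x v := ⟨_, fun _ => rfl⟩
  obtain ⟨Km, hKm⟩ : ∃ Km : T3 → ℝ, ∀ x, Km x = ∫ U : V3, Θ R U * U 0 * κ x U := ⟨_, fun _ => rfl⟩
  obtain ⟨F3, hF3⟩ : ∃ F3 : T3 → ℝ, ∀ x, F3 x = ∫ U : V3, Θ R U * (collisionFrequency U * κ x U) := ⟨_, fun _ => rfl⟩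
  obtain ⟨F4, hF4⟩ : ∃ F4 : T3 → ℝ, ∀ x, F4 x = ∫ v : V3, Θ R v * ∫ p : Metric.sphere (0 : V3) 1 × V3,
      max ⟪v - p.2, (p.1 : V3)⟫_ℝ 0 * globalMaxwellian p.2 * κ (x + Torus.proj (ε • (p.1 : V3))) p.2
        ∂((sphereMeasure : Measure (Metric.sphere (0 : V3) 1)).prod volume) := ⟨_, fun _ => rfl⟩
  obtain ⟨F2', hF2'⟩ : ∃ F2' : T3 → ℝ, ∀ x, F2' x = ∫ ω, (Torus.cosCoord 0 x * Real.cos (2 * π * ε * (ω : V3) 0) +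
      Torus.sinCoord 0 x * Real.sin (2 * π * ε * (ω : V3) 0)) * Ψ x ω
        ∂(sphereMeasure : Measure (Metric.sphere (0 : V3) 1)) := ⟨_, fun _ => rfl⟩
  obtain ⟨E, hE⟩ : ∃ E : T3 → ℝ, ∀ x, E x = Torus.cosCoord 0 x * (∫ ω, Ψ x ω ∂(sphereMeasure : Measure (Metric.sphere (0 : V3) 1))) +
      F2' x - Torus.cosCoord 0 x * F3 x - Torus.cosCoord 0 x * F4 x := ⟨_, fun _ => rfl⟩
  -- the split and the estimate per slice
  have hslice : ∀ x : T3, Φ x = (Y₀ * ρ₀) * ((∫ ω, Ψ x ω ∂(sphereMeasure : Measure (Metric.sphere (0 : V3) 1))) +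
      (∫ ω, Ψ (x + Torus.proj (ε • (ω : V3))) ω ∂(sphereMeasure : Measure (Metric.sphere (0 : V3) 1))) - F3 x - F4 x) ∧
      |E x - π ^ 2 * ε * (Torus.sinCoord 0 x * Km x)| ≤
        C * (∫ U : V3, (1 + ‖U‖ ^ 2) * |k (‖U‖ ^ 2)|) +
        ((2 * π * ε) ^ 2 / 2 + (2 * π * ε) ^ 3 / 6) * C *
          (∫ U : V3, (1 + ‖U‖ ^ 2) * ∫ ω, I R U ω ∂(sphereMeasure : Measure (Metric.sphere (0 : V3) 1))) +
        2 * π * ε * C * (∫ U : V3, |U 0| * (1 + ‖U‖ ^ 2) * |e (‖U‖ ^ 2)|) + 1040 * π * C := by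
    intro x
    obtain ⟨-, hP4le, hgi, hsp⟩ := k2r_ref_ok0_slice_split hΘ hI hR hC hκc hκb Lκ hL Ψ hΨ x
    refine ⟨by rw [hΦ, hF3, hF4]; exact hsp, ?_⟩
    rw [hE, hF2', hF3, hKm]
    exact k2r_ref_ok0_slice_estimate hΘ hI hR hε.le hk hC hκc hκb hkm hkU hkI hem heU heI Ψ hΨ x hgi
      (by rw [hF4]; exact hP4le)
  -- integrability in `x`
  have hcΦ : Integrable (fun x : T3 => Torus.cosCoord 0 x * Φ x) := by
    refine (hInt 1).integral_prod_left.congr (Eventually.of_forall fun x => ?_)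
    show ∫ v : V3, Θ R v * ((1 * Torus.cosCoord 0 x) * Lκ x v) = Torus.cosCoord 0 x * Φ x
    rw [hΦ, ← integral_const_mul]
    exact integral_congr_ae (Eventually.of_forall fun v => by ring)
  have hF2'i : Integrable F2' := hΦ2'i.congr (Eventually.of_forall fun x => (hF2' x).symm)
  have hEi : Integrable E := by
    refine (((hcΦ.sub (hΦ2i.const_mul (Y₀ * ρ₀))).add (hF2'i.const_mul (Y₀ * ρ₀))).const_mul (Y₀ * ρ₀)⁻¹).congr
      (Eventually.of_forall fun x => ?_)
    show (Y₀ * ρ₀)⁻¹ * (Torus.cosCoord 0 x * Φ x - Y₀ * ρ₀ * (Torus.cosCoord 0 x *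
      ∫ ω, Ψ (x + Torus.proj (ε • (ω : V3))) ω ∂(sphereMeasure : Measure (Metric.sphere (0 : V3) 1))) +
      Y₀ * ρ₀ * F2' x) = E x
    rw [(hslice x).1, hE]
    field_simp
    ring
  have hKi : Integrable (fun x : T3 => Torus.sinCoord 0 x * Km x) := by
    have hprod : Integrable (fun p : T3 × V3 => Θ R p.2 * p.2 0 * κ p.1 p.2 * Torus.sinCoord 0 p.1)
        ((volume : Measure T3).prod volume) := by
      refine ((hw4.const_mul C).comp_snd _).mono' ?_ (Eventually.of_forall fun p => ?_)
      · exact ((((hwc.comp continuous_snd).mul ((EuclideanSpace.proj (0 : Fin 3)).continuous.comp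
          continuous_snd)).mul hκc).mul (hsin.comp continuous_fst)).aestronglyMeasurable
      · rw [Real.norm_eq_abs, abs_mul, abs_mul, abs_mul, abs_of_nonneg (hw01 p.2).1]
        have hU0 : |p.2 0| ≤ ‖p.2‖ := by simpa using PiLp.norm_apply_le p.2 0
        have h14 : ‖p.2‖ * (1 + ‖p.2‖ ^ 2) ≤ (1 + ‖p.2‖ ^ 2) ^ 4 := by
          have h1 : ‖p.2‖ ≤ 1 + ‖p.2‖ ^ 2 := by nlinarith [sq_nonneg (‖p.2‖ - 1), norm_nonneg p.2]
          calc ‖p.2‖ * (1 + ‖p.2‖ ^ 2) ≤ (1 + ‖p.2‖ ^ 2) * (1 + ‖p.2‖ ^ 2) := by gcongr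
            _ = (1 + ‖p.2‖ ^ 2) ^ 2 := (sq _).symm
            _ ≤ (1 + ‖p.2‖ ^ 2) ^ 4 := pow_le_pow_right₀ (by nlinarith [sq_nonneg ‖p.2‖]) (by norm_num)
        calc Θ R p.2 * |p.2 0| * |κ p.1 p.2| * |Torus.sinCoord 0 p.1|
            ≤ Θ R p.2 * ‖p.2‖ * (C * (1 + ‖p.2‖ ^ 2)) * 1 := by
              gcongr
              · exact mul_nonneg (mul_nonneg (hw01 p.2).1 (norm_nonneg _)) (by positivity)
              · exact mul_nonneg (hw01 p.2).1 (norm_nonneg _)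
              · exact (hw01 p.2).1
              · exact hκb p.1 p.2
              · exact habss p.1
          _ = C * (Θ R p.2 * (‖p.2‖ * (1 + ‖p.2‖ ^ 2))) := by ring
          _ ≤ C * (Θ R p.2 * (1 + ‖p.2‖ ^ 2) ^ 4) := by gcongr; exact (hw01 p.2).1
    refine hprod.integral_prod_left.congr (Eventually.of_forall fun x => ?_)
    show ∫ U : V3, Θ R U * U 0 * κ x U * Torus.sinCoord 0 x = Torus.sinCoord 0 x * Km x
    rw [integral_mul_const, hKm, mul_comm]
  -- the `x`-integral of the pairing
  have hmain : ∫ x : T3, Torus.cosCoord 0 x * Φ x = (Y₀ * ρ₀) * ∫ x : T3, E x := by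
    have e1 : ∫ x : T3, Torus.cosCoord 0 x * Φ x = ∫ x : T3, (Torus.cosCoord 0 x * Φ x -
        Y₀ * ρ₀ * (Torus.cosCoord 0 x * ∫ ω, Ψ (x + Torus.proj (ε • (ω : V3))) ω
          ∂(sphereMeasure : Measure (Metric.sphere (0 : V3) 1))) + Y₀ * ρ₀ * F2' x) := by
      have i1 : Integrable (fun x : T3 => Y₀ * ρ₀ * (Torus.cosCoord 0 x *
          ∫ ω, Ψ (x + Torus.proj (ε • (ω : V3))) ω ∂(sphereMeasure : Measure (Metric.sphere (0 : V3) 1)))) :=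
        hΦ2i.const_mul _
      have i2 : Integrable (fun x : T3 => Y₀ * ρ₀ * F2' x) := hF2'i.const_mul _
      have i3 : Integrable (fun x : T3 => Torus.cosCoord 0 x * Φ x - Y₀ * ρ₀ * (Torus.cosCoord 0 x *
          ∫ ω, Ψ (x + Torus.proj (ε • (ω : V3))) ω ∂(sphereMeasure : Measure (Metric.sphere (0 : V3) 1)))) :=
        hcΦ.sub i1
      rw [integral_add i3 i2, integral_sub hcΦ i1, integral_const_mul, integral_const_mul, hswap]
      simp only [hF2']
      ring
    rw [e1, ← integral_const_mul]
    refine integral_congr_ae (Eventually.of_forall fun x => ?_)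
    beta_reduce
    rw [(hslice x).1, hE]
    ring
  -- the two sides of the claim in terms of `Φ` and `Km`
  have hlhs : ∀ x : T3, ∫ v : V3, ((1 + ‖v‖ ^ 2) ^ 3)⁻¹ * Real.exp (-‖v‖ ^ 2 / R) *
      ((z * Torus.cosCoord 0 x) * Lκ x v) = z * (Torus.cosCoord 0 x * Φ x) := fun x => by
    rw [hΦ, ← integral_const_mul, ← integral_const_mul]
    exact integral_congr_ae (Eventually.of_forall fun v => by beta_reduce; rw [hΘ]; ring)
  have hrhs : ∀ x : T3, ∫ v : V3, ((1 + ‖v‖ ^ 2) ^ 3)⁻¹ * Real.exp (-‖v‖ ^ 2 / R) * v 0 *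
      Torus.sinCoord 0 x * κ x v = Torus.sinCoord 0 x * Km x := fun x => by
    rw [hKm, ← integral_const_mul]
    exact integral_congr_ae (Eventually.of_forall fun v => by beta_reduce; rw [hΘ]; ring)
  rw [integral_congr_ae (Eventually.of_forall hlhs), integral_congr_ae (Eventually.of_forall hrhs),
    integral_const_mul, hmain]
  -- the estimate, integrated over the probability space `𝕋³`
  set Rest : ℝ := C * (∫ U : V3, (1 + ‖U‖ ^ 2) * |k (‖U‖ ^ 2)|) +
    ((2 * π * ε) ^ 2 / 2 + (2 * π * ε) ^ 3 / 6) * C *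
      (∫ U : V3, (1 + ‖U‖ ^ 2) * ∫ ω, I R U ω ∂(sphereMeasure : Measure (Metric.sphere (0 : V3) 1))) +
    2 * π * ε * C * (∫ U : V3, |U 0| * (1 + ‖U‖ ^ 2) * |e (‖U‖ ^ 2)|) + 1040 * π * C with hRest
  have hdiff : |(∫ x : T3, E x) - π ^ 2 * ε * ∫ x : T3, Torus.sinCoord 0 x * Km x| ≤ Rest := by
    rw [← integral_const_mul, ← integral_sub hEi (hKi.const_mul _), ← Real.norm_eq_abs]
    have h := norm_integral_le_of_norm_le_const (μ := (volume : Measure T3)) (C := Rest)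
      (f := fun x => E x - π ^ 2 * ε * (Torus.sinCoord 0 x * Km x))
      (Eventually.of_forall fun x => by rw [Real.norm_eq_abs]; exact (hslice x).2)
    rwa [probReal_univ, mul_one] at h
  have hJ0 : 0 ≤ ∫ E in Ioi (0 : ℝ), E ^ 2 * (((1 + E) ^ 3)⁻¹ * Real.exp (-E / R)) :=
    setIntegral_nonneg measurableSet_Ioi fun E hE => by
      have : 0 < 1 + E := by linarith [mem_Ioi.1 hE]
      positivity
  have hRle : Rest ≤ C * M₀ + ((2 * π * ε) ^ 2 / 2 + (2 * π * ε) ^ 3 / 6) * C *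
      (32 * π ^ 2 * (∫ E in Ioi (0 : ℝ), E ^ 2 * (((1 + E) ^ 3)⁻¹ * Real.exp (-E / R))) + 1760 * π) +
      2 * π * ε * C * M₂ + 1040 * π * C := by
    rw [hRest]
    gcongr
  set Bnd : ℝ := C * M₀ + ((2 * π * ε) ^ 2 / 2 + (2 * π * ε) ^ 3 / 6) * C *
      (32 * π ^ 2 * (∫ E in Ioi (0 : ℝ), E ^ 2 * (((1 + E) ^ 3)⁻¹ * Real.exp (-E / R))) + 1760 * π) +
      2 * π * ε * C * M₂ + 1040 * π * C with hBnd
  have hBnd0 : 0 ≤ Bnd := by rw [hBnd]; positivity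
  have hfin : |z| * ((Y₀ * ρ₀) * Rest) ≤ (|z| + |z'|) * (Y₀ * ρ₀ * C * (M₀ + ((2 * π * ε) ^ 2 / 2 +
      (2 * π * ε) ^ 3 / 6) * (1760 * π) + 2 * π * ε * M₂ + 1040 * π) + Y₀ * ρ₀ * C * (32 * π ^ 2) *
      ((2 * π * ε) ^ 2 / 2 + (2 * π * ε) ^ 3 / 6) * ∫ E in Ioi (0 : ℝ), E ^ 2 * (((1 + E) ^ 3)⁻¹ * Real.exp (-E / R))) := by
    have hX : (Y₀ * ρ₀) * Bnd =
        Y₀ * ρ₀ * C * (M₀ + ((2 * π * ε) ^ 2 / 2 + (2 * π * ε) ^ 3 / 6) * (1760 * π) + 2 * π * ε * M₂ + 1040 * π) +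
        Y₀ * ρ₀ * C * (32 * π ^ 2) * ((2 * π * ε) ^ 2 / 2 + (2 * π * ε) ^ 3 / 6) *
          ∫ E in Ioi (0 : ℝ), E ^ 2 * (((1 + E) ^ 3)⁻¹ * Real.exp (-E / R)) := by rw [hBnd]; ring
    rw [← hX]
    have h2 : 0 ≤ (Y₀ * ρ₀) * Bnd := mul_nonneg hA.le hBnd0
    calc |z| * ((Y₀ * ρ₀) * Rest) ≤ |z| * ((Y₀ * ρ₀) * Bnd) :=
          mul_le_mul_of_nonneg_left (mul_le_mul_of_nonneg_left hRle hA.le) (abs_nonneg z)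
      _ ≤ |z| * ((Y₀ * ρ₀) * Bnd) + |z'| * ((Y₀ * ρ₀) * Bnd) :=
          le_add_of_nonneg_right (mul_nonneg (abs_nonneg z') h2)
      _ = (|z| + |z'|) * ((Y₀ * ρ₀) * Bnd) := by ring
  refine le_trans ?_ hfin
  rw [show z * ((Y₀ * ρ₀) * ∫ x : T3, E x) - z * (π ^ 2 * ε * (Y₀ * ρ₀)) * ∫ x : T3, Torus.sinCoord 0 x * Km x =
    z * ((Y₀ * ρ₀) * ((∫ x : T3, E x) - π ^ 2 * ε * ∫ x : T3, Torus.sinCoord 0 x * Km x)) by ring,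
    abs_mul, abs_mul, abs_of_pos hA]
  exact mul_le_mul_of_nonneg_left (mul_le_mul_of_nonneg_left hdiff hA.le) (abs_nonneg z)

end Summit.AtomisticToContinuum.HydrodynamicLimit.Theorems.EnskogAdjointDuality
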